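import Summits.BirchSwinnertonDyer.Rank1Residual.X11b.SelmerTorsionControl
import Literature.NumberTheory.EllipticCurves.BigGaloisRepSelmer
import HarnessLib

/-!
# Erratum Lemma 2.1 ∕ [JSW17, Lemma 3.4.1] with TORSION defect, Selmer side (abstract): an element `s` killing the
# `r`-cotorsion of every constrained local invariant module kills `Sel(M)[r] / H¹(ι)(Sel(M[r]))`
# (crux 4 `BSDpOnCellC`, stmt-BirchSwinnertonDyer-19034; helper, closes nothing)

Ideator bsd-idea-12 g36 (W-71/W-79: no route births, nothing registered). Theorems only (no definition, no named fact, no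
`sorry`, no instance, no notation). BSD is proved for no curve; no crux / registered stub / summit statement is proved here.

Companion of `Rank1Residual/X11b/SelmerTorsionControl.lean` (`TorsionControl.map_torsionInclH1_selmer`: the EXACT case, all
constrained local invariants `r`-divisible) and of `Theorems/ErratumRoadFiveSelmerTorsionControlFinite.lean`
(`SelmerFiniteDefect.finite_selmer_torsion_quot`: FINITE `r`-cotorsion at finitely many places). For the weight-two
control map of the branch on Cell C (sub-leaf W2 `K2Weight2.stub_weightTwoControlMap` of the UNREGISTERED workfile
`Cruxes/BSDpOnCellC/Lines/telescopeK2weight2.lean`; pricing memo `Cruxes/BSDpOnCellC/W-PRICING-n2.md` §0(b), (m1)–(m2)) the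
local `r`-cotorsion at `𝔭̄` may be INFINITE but is killed by one element `s` prime to `r`; this file is the matching
Selmer-side statement, the arithmetic-free half of the hypothesis `hs : ∀ y, r • y = 0 → s • y ∈ range θ` of
`TelescopeK2ControlTorsionDefect.exists_quotSMulTop_linearMap_torsionDefect`.

## What is proved

Setting of `TorsionControl` (a topological group `Γ`, continuous `φ_v : Γ_v → Γ`, constrained indices `L ⊆ ι`, a discrete
`A`-linear `Γ`-module `M` on which `r ∈ A` acts surjectively).

* `smul_mem_map_torsionInclH1_selmer` — if `s • M^{Γ_v} ⊆ r • M^{Γ_v}` for every constrained `v`, then for every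
  `y ∈ Sel(M)` with `r • y = 0`: `s • y ∈ H¹(ι)(Sel(M[r]))`.
* `smul_mem_range_torsionInclH1_restrict` — the same in the `LinearMap.range` form over the Selmer subtypes (the shape of the
  hypothesis `hs` of the dual lemma), for the restricted map `Sel(M[r]) → Sel(M)`.
* `smul_mem_map_torsionInclH1_selmer_of_divisible_off` — bookkeeping corollary: `r`-divisible local invariants off a set
  `L₀` and `s`-killed `r`-cotorsion on `L₀`.
* `bigGaloisRep_selmer_eq` — the by-name bridge `BigGaloisRep.selmer φ L ρ = TorsionControl.selmer φ L ρ` (same body; so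
  `BigGaloisRep.selmerBig κ ρ 𝔮 S`, cf. `BigGaloisRep.selmerBig_eq`, is a `TorsionControl.selmer` and the lemmas above apply
  to `X^S_𝔮(𝕋) = (Sel^S_𝔮(K, 𝕋))^∨`).

Proof: lift `y = H¹(ι)(x)` (`exists_cohomologyMap_torsionIncl_eq`); at a constrained `v`, `res_v x` dies in `H¹(Γ_v, M)`
so `res_v x = δ₀,v(w)` for a local invariant `w` (`cohomologyMap_torsionIncl_eq_zero_iff`); then
`res_v (s • x) = δ₀,v(s • w) = δ₀,v(r • w') = 0` (`IsSES.δ₀_eq_zero_iff`), so `s • x ∈ Sel(M[r])` and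
`H¹(ι)(s • x) = s • y`. [folklore]

## References
[cite: JetchevSkinnerWan2017, §3.4, Lemma 3.4.1 (arXiv:1512.06894 p. 14)] [cite: Castella2018Erratum, Lemma 2.1 (p. 2)]
[cite: Ochiai2006, Prop. 5.1 (Compositio 142, p. 1177)] [cite: SerreGaloisCohomology1997, I §2.2]
-/

noncomputable section

open CategoryTheory Literature.NumberTheory.GaloisRepresentations
open scoped ContRepresentation Pointwise

universe u

-- D-0017: single-problem summit, the namespace repeats the problem name by design.
set_option linter.dupNamespace false
set_option autoImplicit false

namespace Summit.BirchSwinnertonDyer.BirchSwinnertonDyer.Theorems.TelescopeK2SelmerTorsionDefect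

open Summit.BirchSwinnertonDyer.Rank1Residual.X11b.TorsionControl

variable {A : Type*} [CommRing A] [TopologicalSpace A]
variable {Γ : Type u} [Group Γ] [TopologicalSpace Γ] [IsTopologicalGroup Γ]
variable {M : Type u} [AddCommGroup M] [Module A M] [TopologicalSpace M] [DiscreteTopology M]
  [ContinuousSMul A M]
variable {ι : Type*} {Γv : ι → Type u} [∀ v, Group (Γv v)] [∀ v, TopologicalSpace (Γv v)]
  [∀ v, IsTopologicalGroup (Γv v)] (φ : ∀ v, Γv v →ₜ* Γ) (L : Set ι)
  (ρ : ContinuousRep Γ A M) (r s : A)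

/-- **Erratum Lemma 2.1 ∕ [JSW17, L. 3.4.1] with torsion defect, Selmer side.** For `r`-divisible `M`: if `s` kills the
`r`-cotorsion `M^{Γ_v}/r·M^{Γ_v}` of the local invariants at EVERY constrained index `v` (`s • w = r • w'`), then for every
`r`-torsion Selmer class `y ∈ Sel(M)`, `s • y` lies in `H¹(ι)(Sel(M[r]))` ("the cokernel of
`H¹(K, M[r]) → Sel(M)[r]` is a subquotient of `⊕_v M^{G_v}/r·M^{G_v}`", elementwise).
[cite: JetchevSkinnerWan2017, §3.4, Lemma 3.4.1 (arXiv:1512.06894 p. 14)] [cite: Castella2018Erratum, Lemma 2.1 (p. 2)] [folklore] -/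
theorem smul_mem_map_torsionInclH1_selmer (hr : Function.Surjective fun m : M => r • m)
    (hkill : ∀ v ∈ L, ∀ w ∈ ((ρ.restrict (φ v)).toTopRep).ρ.invariants,
      ∃ w' ∈ ((ρ.restrict (φ v)).toTopRep).ρ.invariants, r • w' = s • w)
    {y : continuousCohomology 1 ρ.toTopRep} (hy : y ∈ selmer φ L ρ) (hyr : r • y = 0) :
    s • y ∈ Submodule.map (torsionInclH1 ρ r) (selmer φ L (torsionRep ρ r)) := by
  -- a lift of the `r`-torsion class to `H¹(Γ, M[r])`
  obtain ⟨x, hx⟩ := exists_cohomologyMap_torsionIncl_eq ρ r hr y hyr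
  -- `s • x` satisfies every constrained local condition
  have hd : ∀ v ∈ L, resH1 (torsionRep ρ r) (φ v) (s • x) = 0 := by
    intro v hv
    -- `res_v x` dies in `H¹(Γ_v, M)`, hence is `δ₀,v` of a local invariant `w`
    obtain ⟨w, hw⟩ := (cohomologyMap_torsionIncl_eq_zero_iff (ρ.restrict (φ v)) r hr
      (resH1 (torsionRep ρ r) (φ v) x)).1 (by
        have h := resH1_cohomologyMap (φ v) (torsionIncl ρ r) x
        rw [hx] at h
        change (cohomologyMap (restrictHom (φ v) (torsionIncl ρ r)) 1) (resH1 (torsionRep ρ r) (φ v) x) = 0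
        rw [← h]
        exact (mem_selmer_iff φ L ρ _).1 hy v hv)
    -- `s • w = r • w'` with `w'` invariant, so `δ₀,v (s • w) = 0`
    obtain ⟨w', hw', hw'eq⟩ := hkill v hv w.1 w.2
    have h0 : (isSES_torsion (ρ.restrict (φ v)) r hr).δ₀ (s • w) = 0 := by
      rw [(isSES_torsion (ρ.restrict (φ v)) r hr).δ₀_eq_zero_iff]
      exact ⟨w', hw', hw'eq⟩
    rw [map_smul] at h0
    rw [map_smul, ← hw]
    exact h0
  have hmem : s • x ∈ selmer φ L (torsionRep ρ r) := (mem_selmer_iff φ L _ _).2 hd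
  exact Submodule.mem_map.2 ⟨s • x, hmem, by rw [map_smul, torsionInclH1_apply, hx]⟩

/-- **The same, `LinearMap.range` form over the Selmer subtypes** — the shape of the hypothesis `hs` of
`TelescopeK2ControlTorsionDefect.exists_quotSMulTop_linearMap_torsionDefect` for the restricted control map
`θ = H¹(ι)| : Sel(M[r]) → Sel(M)` (`cohomologyMap_mem_selmer`). [cite: JetchevSkinnerWan2017, §3.4, Lemma 3.4.1] [folklore] -/
theorem smul_mem_range_torsionInclH1_restrict (hr : Function.Surjective fun m : M => r • m)
    (hkill : ∀ v ∈ L, ∀ w ∈ ((ρ.restrict (φ v)).toTopRep).ρ.invariants,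
      ∃ w' ∈ ((ρ.restrict (φ v)).toTopRep).ρ.invariants, r • w' = s • w)
    (hmaps : ∀ x ∈ selmer φ L (torsionRep ρ r), torsionInclH1 ρ r x ∈ selmer φ L ρ)
    (y : ↥(selmer φ L ρ)) (hyr : r • y = 0) :
    s • y ∈ LinearMap.range ((torsionInclH1 ρ r).restrict hmaps) := by
  have hyr' : r • (y : continuousCohomology 1 ρ.toTopRep) = 0 := by
    rw [← Submodule.coe_smul, hyr, Submodule.coe_zero]
  obtain ⟨x, hxS, hxy⟩ := Submodule.mem_map.1
    (smul_mem_map_torsionInclH1_selmer φ L ρ r s hr hkill y.2 hyr')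
  refine ⟨⟨x, hxS⟩, Subtype.ext ?_⟩
  rw [LinearMap.restrict_apply, Submodule.coe_smul]
  exact hxy

/-- **`H¹(ι)` maps `Sel(M[r])` into `Sel(M)`** (by-name instance of `cohomologyMap_mem_selmer`, the `hmaps` of
`smul_mem_range_torsionInclH1_restrict`). [folklore] -/
theorem torsionInclH1_mem_selmer {x : continuousCohomology 1 (torsionRep ρ r).toTopRep}
    (hx : x ∈ selmer φ L (torsionRep ρ r)) : torsionInclH1 ρ r x ∈ selmer φ L ρ := by
  rw [torsionInclH1_apply]
  exact cohomologyMap_mem_selmer φ L (torsionIncl ρ r) hx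

/-- **Bookkeeping corollary (`L₀`-form).** If the local invariants are `r`-DIVISIBLE at every constrained `v ∉ L₀` and
their `r`-cotorsion is killed by `s` at every constrained `v ∈ L₀`, then `s • Sel(M)[r] ⊆ H¹(ι)(Sel(M[r]))`.
[cite: JetchevSkinnerWan2017, §3.4, Lemma 3.4.1] [cite: Castella2018Erratum, Lemma 2.1] [folklore] -/
theorem smul_mem_map_torsionInclH1_selmer_of_divisible_off (hr : Function.Surjective fun m : M => r • m)
    (L₀ : Set ι)
    (hloc : ∀ v ∈ L, v ∉ L₀ → ∀ w ∈ ((ρ.restrict (φ v)).toTopRep).ρ.invariants,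
      ∃ w' ∈ ((ρ.restrict (φ v)).toTopRep).ρ.invariants, r • w' = w)
    (hkill : ∀ v ∈ L, v ∈ L₀ → ∀ w ∈ ((ρ.restrict (φ v)).toTopRep).ρ.invariants,
      ∃ w' ∈ ((ρ.restrict (φ v)).toTopRep).ρ.invariants, r • w' = s • w)
    {y : continuousCohomology 1 ρ.toTopRep} (hy : y ∈ selmer φ L ρ) (hyr : r • y = 0) :
    s • y ∈ Submodule.map (torsionInclH1 ρ r) (selmer φ L (torsionRep ρ r)) := by
  classical
  refine smul_mem_map_torsionInclH1_selmer φ L ρ r s hr (fun v hv w hw ↦ ?_) hy hyr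
  by_cases hv₀ : v ∈ L₀
  · exact hkill v hv hv₀ w hw
  · obtain ⟨w', hw', hw'eq⟩ := hloc v hv hv₀ w hw
    exact ⟨s • w', Submodule.smul_mem _ s hw', by rw [smul_comm, hw'eq]⟩

/-- **Bridge between the two Selmer constants**: the Literature interface's `BigGaloisRep.selmer` (body of
`BigGaloisRep.selmerBig`, `selmerBig_eq`) and the kernel's `TorsionControl.selmer` have the same body, hence are equal —
so the torsion-defect lemmas above apply verbatim to `Sel^S_𝔮(K, 𝕋)`. [cite: Castella2018Erratum, §2 (p. 2)] [folklore] -/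
theorem bigGaloisRep_selmer_eq :
    Literature.NumberTheory.EllipticCurves.BigGaloisRep.selmer φ L ρ = selmer φ L ρ :=
  rfl

end Summit.BirchSwinnertonDyer.BirchSwinnertonDyer.Theorems.TelescopeK2SelmerTorsionDefect

end
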